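import Summits.CriticalPhenomena.PercolationContinuityZ3.Theorems.Transplant.SkelFrmQuasiBParamsFaceUnits
import Summits.CriticalPhenomena.PercolationContinuityZ3.Theorems.Transplant.SkelFrmBParamsFaceUnits
import Summits.CriticalPhenomena.PercolationContinuityZ3.Theorems.Transplant.PlanarCells2TDefs
import Summits.CriticalPhenomena.PercolationContinuityZ3.Theorems.Transplant.SkelPhiFaceNumsCross
import Summits.CriticalPhenomena.PercolationContinuityZ3.Theorems.Transplant.SkelNegBParamsFaceCountsA
import Summits.CriticalPhenomena.PercolationContinuityZ3.Theorems.Transplant.PlanarSkeletonFrmQuasiDefs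
import Summits.CriticalPhenomena.PercolationContinuityZ3.Theorems.Transplant.PlanarSkeletonFrmDefs
import Summits.CriticalPhenomena.PercolationContinuityZ3.Theorems.Transplant.SkelPhiStepIDataNS
import Summits.CriticalPhenomena.PercolationContinuityZ3.Theorems.Transplant.SkelFrmQuasi1ParamsLBL
import Summits.CriticalPhenomena.PercolationContinuityZ3.Theorems.Transplant.SkelFrmQuasiBParamsLF
import HarnessLib
import Summits.CriticalPhenomena.PercolationContinuityZ3.Theorems.Transplant.SkelFrmBParamsFaceCountsA
/-!
# GEN-Q PORT (WAVE-Q table v0.8 section 2, row G037, U-level L7; captain R-6/R-7 2026-08-27: carrier token swap `PlanarSkeletonFrmFrom ↦ PlanarSkeletonFrmQuasi`)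
# of the tree module «Transplant/SkelFrmFromBParamsFaceCountsA» (sha256 5926d411959ff642…) onto the quasi-step carrier `PlanarSkeletonFrmQuasi` (p507026): «SkelFrmQuasiBParamsFaceCountsA»

ORIGINAL TITLE: (F) VALUE LAYER, N2 twin (hp-8 g42, 2026-08-23; F-DISCHARGE-MAP-N2 G18 x-face counts, delta (Δ1)/(R-22)): `port_frm.py` text of N1 `SkelNegBParamsFaceCountsA` (p3-g12)

builds on p205010 (kernel theorem, internal audit signed; external expert review pending) — nothing in this file uses p205010; NOTHING is claimed about any open node
((N3-b), the end state).  Lane `prim-bschramm`, seat `prim-bschramm-stmt` (gen 33; GEN-Q column pen; tool = captain gen-1 g4's port_genq.py R-14 --cone + p3-g30's T1 patch).  Helper file (`--supports stmt-CriticalPhenomena-4575 --as helper`).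
PORT RULES (U-wave r1–r4 re-used, GEN-Q hunk classes of p3-g29 #6136): declaration order, names and proof texts are those of «SkelFrmFromBParamsFaceCountsA», byte-identical except
(i) the carrier token `PlanarSkeletonFrmFrom ↦ PlanarSkeletonFrmQuasi` in binders, `namespace`/`end` lines and qualified names (module names `SkelFrmFrom… ↦ SkelFrmQuasi…`
in imports of already-ported rows); (ii) `Φ.step ↦ Φ.qstep` with the called Steps lemma replaced by its `…Q`/`_q` twin and the cost `Φ.M` threaded (none in this file unless
listed below); (iii) `Φ.cyl_connected ↦ Φ.cyl_reach` readers (none unless listed); (iv) graph-ball radii / window floors ×`Φ.M` (none unless listed).  Carrier-free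
residents stay imported/exported from the original «SkelFrmBParamsFaceCountsA» exactly as in the FrmFrom port.  Docstrings and citations are the original's.

-/

noncomputable section

open scoped Classical

namespace Summit.CriticalPhenomena.PercolationContinuityZ3.Theorems.Transplant

namespace PlanarSkeletonFrmQuasi

namespace NegB

open Literature.Probability.Percolation Literature.Probability.LatticeModels SimpleGraph
open Literature.Probability.Percolation.KozmaNitzan.Cells (oth sgOf sgOf_sign stepVec_apply_fst stepVec_apply_oth)
open SkelConc (Consts)
open Skelφ.StepI (DataN)
open TwoAxis.Para (modulus)
open Neg

namespace KS

section FaceCounts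

export PlanarSkeletonFrm.NegB.KS (T0X)

export PlanarSkeletonFrm.NegB.KS (T1X)

-- GEN-Q (R-2, captain 2026-08-27): `PlanarSkeletonFrmFrom.NegB.KS.σTX` is not in the used cone of the node top — not ported.

-- GEN-Q (R-2, captain 2026-08-27): `PlanarSkeletonFrmFrom.NegB.KS.N3X` is not in the used cone of the node top — not ported.

/-- **The cross-shifted along origin** `yL + (σT·v_L, σT·h_L·v_L/n_L)` (`Skelφ.crossOffX` at zero strides). [this work] -/
def yTX0 (κ : Consts) {V : Type} [DecidableEq V] [Countable V] {G : SimpleGraph V} [G.LocallyFinite] (Φ : PlanarSkeletonFrmQuasi G) (t : V) (p : unitInterval) (D : Skelφ.StepI.DataNS V) (g : ℕ) (f : ℕ) (yL : Site 2) (σT : ℤ) : Site 2 :=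
  yL + Skelφ.pt (σT * vL κ Φ t p D g f) (σT * hL κ Φ t p D g f * vL κ Φ t p D g f / (nL κ Φ t p D g f : ℤ))

/-- **The along count** `NrX := round(σ·(T0X − FcA(yTX0))/u₀) − 1` (clipped at `0`). [this work] -/
def NrX (κ : Consts) {V : Type} [DecidableEq V] [Countable V] {G : SimpleGraph V} [G.LocallyFinite] (Φ : PlanarSkeletonFrmQuasi G) (t : V) (p : unitInterval) (D : Skelφ.StepI.DataNS V) (g : ℕ) (f : ℕ) (P : PCells2T) (yL : Site 2) (σT : ℤ) (x : Site 2) (du : MDir) (z : Site 2) : ℕ :=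
  Int.toNat ((sgOf du * (T0X P x du z - FcA κ Φ t p D g f (yTX0 κ Φ t p D g f yL σT)) + u₀A κ Φ t p D g f / 2) / u₀A κ Φ t p D g f - 1)

export PlanarSkeletonFrm.NegB.KS (T0X_eq)

export PlanarSkeletonFrm.NegB.KS (cenS_step_one)

/-- **One `u`-stride adds exactly `u₀` to the along reading**: `FcA (y + k·(n_L, h_L)) = FcA y + k·u₀` (`Λ₀` gains `k·m`, `A` cancels). [folklore] -/
theorem FcA_add_stride (κ : Consts) {V : Type} [DecidableEq V] [Countable V] {G : SimpleGraph V} [G.LocallyFinite] (Φ : PlanarSkeletonFrmQuasi G) (t : V) (p : unitInterval) (D : Skelφ.StepI.DataNS V) (g : ℕ) (f : ℕ) (hN : EqNumL κ Φ t p D g f) (y : Site 2) (k : ℤ) :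
    FcA κ Φ t p D g f (y + Skelφ.pt (k * nL κ Φ t p D g f) (k * hL κ Φ t p D g f)) = FcA κ Φ t p D g f y + k * u₀A κ Φ t p D g f := by
  obtain ⟨hn1, hℓ1⟩ := one_le_of_eqNumL κ Φ t p D g f hN
  have hm : 0 < modulus (nL κ Φ t p D g f) (hL κ Φ t p D g f) (vL κ Φ t p D g f) (vβL κ Φ t p D g f) := Skelφ.NegPrm.modulus_vβOf_pos hn1 hℓ1 _ _
  rw [FcA_eq, FcA_eq]
  have hΛ : Λ₀of κ Φ t p D g f (y + Skelφ.pt (k * nL κ Φ t p D g f) (k * hL κ Φ t p D g f)) =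
      Λ₀of κ Φ t p D g f y + k * modulus (nL κ Φ t p D g f) (hL κ Φ t p D g f) (vL κ Φ t p D g f) (vβL κ Φ t p D g f) := by
    unfold Λ₀of vβL TwoAxis.Para.modulus
    simp only [Pi.add_apply, Skelφ.pt_zero, Skelφ.pt_one]
    ring
  rw [hΛ]
  set m := modulus (nL κ Φ t p D g f) (hL κ Φ t p D g f) (vL κ Φ t p D g f) (vβL κ Φ t p D g f)
  have e : 2 * u₀A κ Φ t p D g f * (Λ₀of κ Φ t p D g f y + k * m) + m = 2 * u₀A κ Φ t p D g f * Λ₀of κ Φ t p D g f y + m + k * u₀A κ Φ t p D g f * (2 * m) := by ring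
  rw [e, Int.add_mul_ediv_right _ _ (by linarith)]

/-- `crossOffX` splits into the zero-stride cross shift and `(Nr+1)` signed strides. [folklore] -/
theorem crossOffX_eq (κ : Consts) {V : Type} [DecidableEq V] [Countable V] {G : SimpleGraph V} [G.LocallyFinite] (Φ : PlanarSkeletonFrmQuasi G) (t : V) (p : unitInterval) (D : Skelφ.StepI.DataNS V) (g : ℕ) (f : ℕ) (yL : Site 2) (σ σT : ℤ) (Nr : ℕ) :
    yL + Skelφ.crossOffX (nL κ Φ t p D g f) (hL κ Φ t p D g f) (vL κ Φ t p D g f) σ σT Nr =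
      yTX0 κ Φ t p D g f yL σT + Skelφ.pt ((σ * ((Nr : ℤ) + 1)) * nL κ Φ t p D g f) ((σ * ((Nr : ℤ) + 1)) * hL κ Φ t p D g f) := by
  unfold yTX0 Skelφ.crossOffX
  funext i
  simp only [Pi.add_apply]
  fin_cases i <;> simp [Skelφ.pt] <;> ring

/-- **THE EXACT SHIFT**: the tangential origin's along reading is the cross-shifted origin's plus `σ·u₀·(Nr+1)`. [folklore] -/
theorem FcA_crossOffX (κ : Consts) {V : Type} [DecidableEq V] [Countable V] {G : SimpleGraph V} [G.LocallyFinite] (Φ : PlanarSkeletonFrmQuasi G) (t : V) (p : unitInterval) (D : Skelφ.StepI.DataNS V) (g : ℕ) (f : ℕ) (hN : EqNumL κ Φ t p D g f) (yL : Site 2) (σ σT : ℤ) (Nr : ℕ) :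
    FcA κ Φ t p D g f (yL + Skelφ.crossOffX (nL κ Φ t p D g f) (hL κ Φ t p D g f) (vL κ Φ t p D g f) σ σT Nr) =
      FcA κ Φ t p D g f (yTX0 κ Φ t p D g f yL σT) + σ * u₀A κ Φ t p D g f * ((Nr : ℤ) + 1) := by
  rw [crossOffX_eq, FcA_add_stride κ Φ t p D g f hN]; ring

export PlanarSkeletonNeg.NegB.KS (round_count)

-- GEN-Q (R-2, captain 2026-08-27): `PlanarSkeletonFrmFrom.NegB.KS.N3X_spec` is not in the used cone of the node top — not ported.

/-- **The along choice is admissible** (target at least one stride ahead of the cross-shifted origin): the x-run's end reading is within one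
stride of the arrival target and the count is bounded by the distance. [cite: KozmaNitzan2024, §4 Lemma 11 (p. 22)] -/
theorem NrX_spec (κ : Consts) {V : Type} [DecidableEq V] [Countable V] {G : SimpleGraph V} [G.LocallyFinite] (Φ : PlanarSkeletonFrmQuasi G) (t : V) (p : unitInterval) (D : Skelφ.StepI.DataNS V) (g : ℕ) (f : ℕ) (P : PCells2T) (hN : EqNumL κ Φ t p D g f) (yL : Site 2) (σT : ℤ) (x : Site 2) (du : MDir) (z : Site 2)
    (hX : u₀A κ Φ t p D g f ≤ sgOf du * (T0X P x du z - FcA κ Φ t p D g f (yTX0 κ Φ t p D g f yL σT))) :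
    |FcA κ Φ t p D g f (yL + Skelφ.crossOffX (nL κ Φ t p D g f) (hL κ Φ t p D g f) (vL κ Φ t p D g f) (sgOf du) σT (NrX κ Φ t p D g f P yL σT x du z)) -
        T0X P x du z| ≤ u₀A κ Φ t p D g f ∧
      u₀A κ Φ t p D g f * ((NrX κ Φ t p D g f P yL σT x du z : ℤ) + 1) ≤
        sgOf du * (T0X P x du z - FcA κ Φ t p D g f (yTX0 κ Φ t p D g f yL σT)) + u₀A κ Φ t p D g f := by
  have hu : 1 ≤ u₀A κ Φ t p D g f := (units_eqA κ Φ t p D g f).2.2.2.2.1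
  have hσ : sgOf du = 1 ∨ sgOf du = -1 := sgOf_sign du
  rw [FcA_crossOffX κ Φ t p D g f hN]
  set u := u₀A κ Φ t p D g f
  set T := T0X P x du z
  set F := FcA κ Φ t p D g f (yTX0 κ Φ t p D g f yL σT)
  obtain ⟨r1, r2⟩ := round_count (X := sgOf du * (T - F)) (by linarith) hX
  have hNr : (NrX κ Φ t p D g f P yL σT x du z : ℤ) = ((Int.toNat ((sgOf du * (T - F) + u / 2) / u - 1) : ℕ) : ℤ) := rfl
  rw [hNr]
  refine ⟨?_, r2⟩
  set M : ℤ := ((Int.toNat ((sgOf du * (T - F) + u / 2) / u - 1) : ℕ) : ℤ)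
  obtain ⟨a1, a2⟩ := abs_le.1 r1
  rcases hσ with h | h <;> rw [h] at a1 a2 ⊢ <;> rw [abs_le] <;> constructor <;> linarith

end FaceCounts

end KS

end NegB

end PlanarSkeletonFrmQuasi

end Summit.CriticalPhenomena.PercolationContinuityZ3.Theorems.Transplant

end
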